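import Summits.AtomisticToContinuum.Crystallization.Theorems.FreeSplittingCertificatesStrictSplittingRuleTorusQForm
import Summits.AtomisticToContinuum.Crystallization.Theorems.FreeSplittingCertificatesStrictSplittingRuleTorusModel442Beta
import Summits.AtomisticToContinuum.Crystallization.Theorems.FreeSplittingCertificatesStrictSplittingRuleTorusModel442Tables

/-!
# The joint (r6) sitewise LMI of crux `StrictSplittingRule` on the hcp torus 4×4×2 — the MODEL in Lean (H12⋆, finite model)

Route `FreeSplittingCertificates`, crux `StrictSplittingRule` (stmt-AtomisticToContinuum-12560); unit b2b-freesplit-B (block 2b,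
PART B, gen 1).  **VALUE = a kernel-accepted (computational lane) theorem about a FINITE model — NOT summit progress.**
Nothing here proves the registered stub `stub_coreJointCoercive` (`CoreJointCoercive a h (1/3) (1/12)` at the hcp-family
minimiser: an infinite-dimensional Bravais-covariant LMI, file `…StrictSplittingRuleCoreJointDefs.lean`).

What this file (with `…TorusModel442A.lean` / `…TorusModel442B.lean`, which hold the theorems) adds over the gen-0 certificates (`…TorusLMI442A/B.lean`, `…TorusLMI663*.lean`, which certify anonymous
integer blocks produced by the Python tool `tlmi/job2.py`): here the finite model ITSELF is written in Lean — torus,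
hcp geometry, Lennard-Jones weights, least-squares co-rotation, supply / demand / readout form / transfers, verbatim the
terms of `CoreJointSiteIneq` — and the theorem quantifies over displacement fields.  The only computation outside Lean is
the SEARCH for the witness tables (kit job j037531); their adequacy is checked inside Lean (`native_decide`, axiom
`Lean.ofReduceBool`: COMPUTATIONAL regime).

## The model (exactly; cf. HOME run/shared/lean/b2b/freesplit-r2/CERT.md §1)

* Torus `T = ℤ₄ × ℤ₄ × ℤ₄ ∋ (k, i, j)` (`2N₃ = 4` layers ABAB, `N₁ = 4`), `Site = Fin 4 × Fin 4 × Fin 4`, parity `A ⇔ k even`;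
  hcp positions `y = i·u + j·v + L(k)·w + k·h₀·e₃`, `L(k) = k mod 2` (= `hcpSite a h` of the tree), written in the SCALED
  RATIONAL FRAME `(x, y/√3, z)` with metric `G = diag(1,3,1)` (`ipG`), at `(a₀, h₀) = (97129/100000, 39647/50000)` (the
  hcp-family LJ minimiser to 5 decimals).  `V b d` = relative position of lattice offset `d` seen from a site of parity `b`.
* Displacements `u : Fin 192 → ℚ`, coordinate `idx q c = 3·(16k+4i+j)+c`; `eRel p q c = u_{q,c} − u_{p,c}`.
* Least-squares co-rotation (`theta`, `Wy`): `W_p(u) = G⁻¹·(Σ_k θ_k E_k)` is THE `G`-skew map minimising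
  `Σ_{s ∈ shell} ‖e_s − W·V s‖²_G` over p's 12 first-shell neighbours (normal equations `J θ = Σ_s C_sᵀ e_s`,
  `J = Σ_s C_sᵀ G⁻¹ C_s`, solved with the exact inverse `inv3`; `C_y[r][k] = (E_k y)_r`).
* SUPPLY `S_p(u) = Σ_{d ≠ 0, ‖V b d‖ ≤ 4.02 a₀ (periodic images included)} [½W̃′(s)‖e_d − W V d‖²_G + W̃″(s)⟨V d, e_d⟩²_G]`,
  `s = ‖V b d‖²`, `W′(s) = ½(s⁻⁴ − s⁻⁷)` (= `ljSqDeriv`), `W″(s) = ½(7s⁻⁸ − 4s⁻⁵)`, both ROUNDED to 60 fractional bits (`rnd 60`)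
  — the co-rotated half-split second variation, the right side of `CoreJointSiteIneq` truncated at `4.02 a₀`;
  TRANSFERS `T_p(u)`: for every pair class `(b, d, bq, X)` of `tableEntries442`, `+X(dl(p), dl(p+d))` at first sites and
  `−X(dl(p−d), dl(p))` at partners, `dl(m)` = the 12 first-shell elongations `⟨V s, u_{m+s} − u_m⟩_G` (the `(M, N)` format of
  `CoreJointCoercive`; antisymmetric, so `Σ_p T_p = 0`).
* DEMAND `D_p(u) = κ₁Σ_shell⟨V s, e_s⟩²_G + κ₃Σ_shell‖e_s − W V s‖²_G + R_p(u)`, `(κ₁, κ₃) = (1/3, 1/12)`, with the READOUT FORM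
  `R_p(u) = Σ_{bonds (q,q+s), s ∈ Y₁, both ends within 4.02 a₀ of p, q = p included} β(b_q)(p−q)(s)·½‖u_{q+s} − u_q − W V s‖²_G`,
  `β` = the landed line-truss design (`betaEntries442`, dyadic data; the `q = p` own-bond convention of CERT.md §1).
* THEOREMS (files `…TorusModel442A.lean`, `…TorusModel442B.lean`; per parity, at the reference sites `(0,0,0)` / `(1,0,0)` —
  every site of a parity is a translate): `jointLMI442A : demand siteA u + m·‖u‖²_G ≤ supply siteA u + transfer siteA u + meanProj u`
  for ALL `u : Fin 192 → ℚ`, `m = margin442 = 39101/2²⁰ = 0.0373`, where `meanProj u = Σ_c g_c/64·(Σ_q u_{q,c})²` vanishes on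
  zero-mean fields (`jointLMI442A_zeroMean`); same for B.  Proof: `evalQ_nonneg_of_certDD` (…TorusQForm.lean) + ONE
  `native_decide` checking `PSD.IsGramCertDD` (trusted predicate of `Literature/Computation/Certificates/PosSemidef.lean`) on the
  matrix ASSEMBLED IN LEAN from the term lists below (`matA`, `matB`), with a rounded `LDLᵀ` factor also computed in Lean
  (`factA`, `factB` = `certArrays 40 (1/1000)`).
* Cross-checks outside Lean: the matrix assembled from these definitions equals, entry by entry, the exact matrix of the
  independent Python model `tlmi.py` (gen 0) for the same data (work/mirror442.py, crosscheck442.py: max difference 0), and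
  `λ_min = 0.0426` (job j037531) resp. `0.00533` after subtracting `m·G` (float).
-/

namespace Summit.AtomisticToContinuum.Crystallization.Theorems.StrictSplittingRuleTorusLMI

open Literature.Computation.Certificates

/-! ## Torus, geometry, metric -/

/-- Lattice index offsets `(dk, di, dj)`. [folklore] -/
abbrev Off := ℤ × ℤ × ℤ

/-- Sites of the torus `ℤ₄ × ℤ₄ × ℤ₄`: `(k, i, j)`, `k` = layer. [folklore] -/
abbrev Site := Fin 4 × Fin 4 × Fin 4

/-- In-layer lattice parameter `a₀ = 0.97129`. -/
def a0 : ℚ := 97129 / 100000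
/-- Layer spacing `h₀ = 0.79294`. -/
def h0 : ℚ := 39647 / 50000
/-- `κ₁ = 1/3` (radial stretches). -/
def kappa1 : ℚ := 1 / 3
/-- `κ₃ = 1/12` (recentred rotations). -/
def kappa3 : ℚ := 1 / 12
/-- Squared cut-off `(4.02 a₀)²` of the pair terms and of the readout bonds. -/
def Rc2 : ℚ := (402 / 100) ^ 2 * a0 ^ 2
/-- The certified margin `m = 39101 / 2²⁰ = 0.037290…` (identity-normalised, Cartesian norm). -/
def margin442 : ℚ := 39101 / 2 ^ 20

/-- Metric of the scaled frame `(x, y/√3, z)`: `G = diag(1, 3, 1)`. [folklore] -/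
def gW (c : Fin 3) : ℚ := if c = 1 then 3 else 1

/-- Inner product `⟨x, y⟩_G`. [folklore] -/
def ipG (x y : Fin 3 → ℚ) : ℚ := gW 0 * x 0 * y 0 + gW 1 * x 1 * y 1 + gW 2 * x 2 * y 2

/-- Parity of a site: `true` = A layer (`k` even). [folklore] -/
def parity (p : Site) : Bool := p.1.val % 2 == 0

/-- `L(k) = k mod 2` (which of the two in-layer offsets the layer carries). [folklore] -/
def Lk (k : ℤ) : ℤ := k % 2

/-- Relative position `V b d` (scaled frame) of the lattice site `p + d` seen from `p` of parity `b`: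
`(di·a₀ + dj·a₀/2 + dL·a₀/2, dj·a₀/2 + dL·a₀/6, dk·h₀)`, `dL = L(k_p + dk) − L(k_p)`. [folklore] -/
def V (b : Bool) (d : Off) : Fin 3 → ℚ :=
  let kp : ℤ := if b then 0 else 1
  let dL : ℚ := ((Lk (kp + d.1) - Lk kp : ℤ) : ℚ)
  fun c => if c = 0 then (d.2.1 : ℚ) * a0 + (d.2.2 : ℚ) * a0 / 2 + dL * a0 / 2
    else if c = 1 then (d.2.2 : ℚ) * a0 / 2 + dL * a0 / 6 else (d.1 : ℚ) * h0

/-- Reduction mod 4. [folklore] -/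
def zmod4 (z : ℤ) : Fin 4 := ⟨(z % 4).toNat, by omega⟩

/-- Torus addition `p + d`. [folklore] -/
def tadd (p : Site) (d : Off) : Site :=
  (zmod4 (p.1.val + d.1), zmod4 (p.2.1.val + d.2.1), zmod4 (p.2.2.val + d.2.2))

/-- Negated offset. [folklore] -/
def negOff (d : Off) : Off := (-d.1, -d.2.1, -d.2.2)

/-- Displacement coordinate index: `idx (k,i,j) c = 3·(16k + 4i + j) + c`. [folklore] -/
def idx (q : Site) (c : Fin 3) : Fin 192 :=
  ⟨3 * (16 * q.1.val + 4 * q.2.1.val + q.2.2.val) + c.val, by omega⟩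

/-- First-shell stencil of an A site (= `hcpStarIdx`). [folklore] -/
def shellA : List Off := [(0, 1, 0), (0, -1, 0), (0, 0, 1), (0, 0, -1), (0, 1, -1), (0, -1, 1),
  (1, 0, 0), (1, -1, 0), (1, 0, -1), (-1, 0, 0), (-1, -1, 0), (-1, 0, -1)]
/-- First-shell stencil of a B site. [folklore] -/
def shellB : List Off := [(0, 1, 0), (0, -1, 0), (0, 0, 1), (0, 0, -1), (0, 1, -1), (0, -1, 1),
  (1, 0, 0), (1, 1, 0), (1, 0, 1), (-1, 0, 0), (-1, 1, 0), (-1, 0, 1)]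
/-- First shell by parity. [folklore] -/
def shell (b : Bool) : List Off := if b then shellA else shellB
/-- First-order stencil `Y₁` (Bravais vectors `u, v, v − u, 2h e₃`). [folklore] -/
def Y1 : List Off := [(0, 1, 0), (0, 0, 1), (0, -1, 1), (2, 0, 0)]

/-- Integer range `[lo, hi]`. [folklore] -/
def irange (lo hi : ℤ) : List ℤ := (List.range (hi - lo + 1).toNat).map fun n => lo + (n : ℤ)

/-- All lattice offsets `d ≠ 0` with `‖V b d‖²_G ≤ R2` (searched in the box `|dk| ≤ 6, |di|, |dj| ≤ 11`, which contains the
ball of radius `4.02 a₀`). [folklore] -/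
def offsets (b : Bool) (R2 : ℚ) : List Off :=
  ((irange (-6) 6).flatMap fun dk => (irange (-11) 11).flatMap fun di => (irange (-11) 11).map fun dj => (dk, di, dj)).filter
    fun d => d ≠ (0, 0, 0) ∧ ipG (V b d) (V b d) ≤ R2

/-- All 64 sites. [folklore] -/
def allSites : List Site :=
  (List.finRange 4).flatMap fun k => (List.finRange 4).flatMap fun i => (List.finRange 4).map fun j => (k, i, j)

/-! ## Lennard-Jones weights (`W(s) = V_LJ(√s)`, tree normalisation) -/

/-- `W′(s) = ½(s⁻⁴ − s⁻⁷)` (= `ljSqDeriv`). [folklore] -/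
def ljW1 (s : ℚ) : ℚ := ((1 / s) ^ 4 - (1 / s) ^ 7) / 2
/-- `W″(s) = ½(7s⁻⁸ − 4s⁻⁵)`. [folklore] -/
def ljW2 (s : ℚ) : ℚ := (7 * (1 / s) ^ 8 - 4 * (1 / s) ^ 5) / 2

/-! ## Linear functionals of the displacement field -/

/-- Insert a (coordinate, coefficient) pair, merging with an existing entry of the same coordinate. [folklore] -/
def insertAdd (p : Fin 192 × ℚ) : LinF 192 → LinF 192
  | [] => [p]
  | q :: t => if q.1 = p.1 then (q.1, q.2 + p.2) :: t else q :: insertAdd p t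

/-- `insertAdd` adds `p.2 · u p.1` to the value. [folklore] -/
theorem eval_insertAdd (p : Fin 192 × ℚ) (ℓ : LinF 192) (u : Fin 192 → ℚ) :
    LinF.eval (insertAdd p ℓ) u = p.2 * u p.1 + LinF.eval ℓ u := by
  induction ℓ with
  | nil => simp [insertAdd]
  | cons q t ih =>
    by_cases h : q.1 = p.1
    · simp only [insertAdd, h, if_true, LinF.eval_cons]; ring
    · simp only [insertAdd, h, if_false, LinF.eval_cons, ih]; ring

/-- Merge repeated coordinates (same functional, shorter list). [folklore] -/
def compress (ℓ : LinF 192) : LinF 192 := ℓ.foldr insertAdd []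

/-- `compress` does not change the functional. [folklore] -/
theorem eval_compress (ℓ : LinF 192) (u : Fin 192 → ℚ) : LinF.eval (compress ℓ) u = LinF.eval ℓ u := by
  induction ℓ with
  | nil => simp [compress]
  | cons q t ih =>
    simp only [compress, List.foldr_cons] at ih ⊢
    rw [eval_insertAdd, ih, LinF.eval_cons]


/-- `u_{q,c} − u_{p,c}`. [folklore] -/
def eRel (p q : Site) (c : Fin 3) : LinF 192 := [(idx q c, 1), (idx p c, -1)]

/-- `⟨y, F(u)⟩_G` for a vector-valued functional `F`. [folklore] -/
def dotG (y : Fin 3 → ℚ) (F : Fin 3 → LinF 192) : LinF 192 :=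
  (LinF.smul (gW 0 * y 0) (F 0)).add ((LinF.smul (gW 1 * y 1) (F 1)).add (LinF.smul (gW 2 * y 2) (F 2)))

/-- The basis `E_k` of antisymmetric matrices: `E_k` has `+1` at `(i,j)`, `−1` at `(j,i)`, `(i,j) = (0,1),(0,2),(1,2)`;
`Cmat y r k = (E_k y)_r`. [folklore] -/
def Cmat (y : Fin 3 → ℚ) (r k : Fin 3) : ℚ :=
  let i : Fin 3 := if k = 2 then 1 else 0
  let j : Fin 3 := if k = 0 then 1 else 2
  (if r = i then y j else 0) + (if r = j then -(y i) else 0)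

/-- Normal matrix `J = Σ_{s ∈ shell} C_sᵀ G⁻¹ C_s` of the least-squares rotation fit. [folklore] -/
def Jmat (b : Bool) (k l : Fin 3) : ℚ :=
  ((shell b).map fun s => (Cmat (V b s) 0 k * Cmat (V b s) 0 l / gW 0 + Cmat (V b s) 1 k * Cmat (V b s) 1 l / gW 1 +
    Cmat (V b s) 2 k * Cmat (V b s) 2 l / gW 2)).sum

/-- Exact inverse of a `3 × 3` matrix (adjugate / determinant). [folklore] -/
def inv3 (M : Fin 3 → Fin 3 → ℚ) (r c : Fin 3) : ℚ :=
  let a := M 0 0; let b := M 0 1; let cc := M 0 2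
  let d := M 1 0; let e := M 1 1; let f := M 1 2
  let g := M 2 0; let h := M 2 1; let i := M 2 2
  let det := a * (e * i - f * h) - b * (d * i - f * g) + cc * (d * h - e * g)
  let adj : Fin 3 → Fin 3 → ℚ := fun r c =>
    if r = 0 then (if c = 0 then e * i - f * h else if c = 1 then -(b * i - cc * h) else b * f - cc * e)
    else if r = 1 then (if c = 0 then -(d * i - f * g) else if c = 1 then a * i - cc * g else -(a * f - cc * d))
    else (if c = 0 then d * h - e * g else if c = 1 then -(a * h - b * g) else a * e - b * d)
  adj r c / det

/-- `θ_k(u) = Σ_l (J⁻¹)_{kl} Σ_{s ∈ shell} Σ_r C_s[r][l] · (u_{p+s} − u_p)_r` — the least-squares rotation parameters of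
site `p` (coordinates merged). [folklore] -/
def theta (p : Site) (k : Fin 3) : LinF 192 :=
  let b := parity p
  let Ji := inv3 (Jmat b)
  compress <| (shell b).flatMap fun s => [(0 : Fin 3), 1, 2].flatMap fun r =>
    LinF.smul (Ji k 0 * Cmat (V b s) r 0 + Ji k 1 * Cmat (V b s) r 1 + Ji k 2 * Cmat (V b s) r 2) (eRel p (tadd p s) r)

/-- The three rotation functionals `[θ₀, θ₁, θ₂]` of `p` (a plain list, computed once per site and passed along). [folklore] -/
def thetaList (p : Site) : List (LinF 192) := [theta p 0, theta p 1, theta p 2]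

/-- `(W(u) y)_r = (1/g_r) Σ_k C_y[r][k] θ_k(u)` — the fitted infinitesimal rotation applied to `y` (`ths` = the rotation
functionals of the centre site). [folklore] -/
def Wy (ths : List (LinF 192)) (y : Fin 3 → ℚ) (r : Fin 3) : LinF 192 :=
  compress <| LinF.smul (Cmat y r 0 / gW r) (ths.getD 0 []) ++ LinF.smul (Cmat y r 1 / gW r) (ths.getD 1 []) ++
    LinF.smul (Cmat y r 2 / gW r) (ths.getD 2 [])

/-- Co-rotated residual `(u_q − u_m − W(u) y)_c` of the bond `(m, q)` with reference vector `y`. [folklore] -/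
def resid (ths : List (LinF 192)) (m q : Site) (y : Fin 3 → ℚ) (c : Fin 3) : LinF 192 := (eRel m q c).sub (Wy ths y c)

/-- The 12 first-shell bond elongations `dl(m) = (⟨V s, u_{m+s} − u_m⟩_G)_{s ∈ shell}`. [folklore] -/
def dl (m : Site) : List (LinF 192) :=
  (shell (parity m)).map fun s => dotG (V (parity m) s) (fun c => eRel m (tadd m s) c)

/-! ## The terms of the inequality -/

/-- A weighted square `c · ℓ(u)²`. [folklore] -/
def sq (c : ℚ) (ℓ : LinF 192) : Term 192 := (c, ℓ, ℓ)

/-- SUPPLY terms at `p`: for every offset `d` in range, `½W̃′(s)·g_c·(e_d − W V d)_c²` (`c = 0,1,2`) and `W̃″(s)·⟨V d, e_d⟩²_G`.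
[folklore] -/
def supplyTerms (p : Site) (ths : List (LinF 192)) : List (Term 192) :=
  let b := parity p
  (offsets b Rc2).flatMap fun d =>
    let y := V b d
    let s := ipG y y
    let q := tadd p d
    [sq (rnd 60 (ljW1 s) / 2 * gW 0) (resid ths p q y 0), sq (rnd 60 (ljW1 s) / 2 * gW 1) (resid ths p q y 1),
      sq (rnd 60 (ljW1 s) / 2 * gW 2) (resid ths p q y 2), sq (rnd 60 (ljW2 s)) (dotG y fun c => eRel p q c)]

/-- κ-DEMAND terms at `p`: `κ₁⟨V s, e_s⟩²_G` and `κ₃·g_c·(e_s − W V s)_c²` over the 12 shell sites. [folklore] -/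
def kappaTerms (p : Site) (ths : List (LinF 192)) : List (Term 192) :=
  let b := parity p
  (shell b).flatMap fun s =>
    let y := V b s
    let q := tadd p s
    [sq kappa1 (dotG y fun c => eRel p q c), sq (kappa3 * gW 0) (resid ths p q y 0), sq (kappa3 * gW 1) (resid ths p q y 1),
      sq (kappa3 * gW 2) (resid ths p q y 2)]

/-- Decoded `β` data: `((b, d, s), v/2⁴⁰)` from the raw rows `[b, dk, di, dj, sk, si, sj, v]`. [folklore] -/
def betaTable : List ((Bool × Off × Off) × ℚ) :=
  betaRaw442.filterMap fun r =>
    match r with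
    | [b, dk, di, dj, sk, si, sj, v] => some ((b == 1, (dk, di, dj), (sk, si, sj)), (v : ℚ) / 2 ^ 40)
    | _ => none

/-- `β(b)(d)(s)` from the (decoded) data `btab` (`0` if absent). [folklore] -/
def betaLookup (btab : List ((Bool × Off × Off) × ℚ)) (b : Bool) (d s : Off) : ℚ :=
  match btab.find? fun e => e.1 == (b, d, s) with
  | some e => e.2
  | none => 0

/-- READOUT-FORM terms at `p` (demand side): for `q = p + d` (`d = 0` included) and `s ∈ Y₁` with both bond ends within
`4.02 a₀`: `β(b_q)(p−q)(s)·½·g_c·(u_{q+s} − u_q − W V s)_c²`. [folklore] -/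
def readoutTerms (p : Site) (ths : List (LinF 192)) (btab : List ((Bool × Off × Off) × ℚ)) : List (Term 192) :=
  let b := parity p
  (((0, 0, 0) : Off) :: offsets b Rc2).flatMap fun d =>
    let bq := if d.1 % 2 = 0 then b else !b
    let q := tadd p d
    let yq := V b d
    Y1.flatMap fun s =>
      let bv := betaLookup btab bq (negOff d) s
      let ys := V true s
      if bv = 0 then [] else
        if ipG (fun c => yq c + ys c) (fun c => yq c + ys c) ≤ Rc2 then
          [sq (bv / 2 * gW 0) (resid ths q (tadd q s) ys 0), sq (bv / 2 * gW 1) (resid ths q (tadd q s) ys 1),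
            sq (bv / 2 * gW 2) (resid ths q (tadd q s) ys 2)]
        else []

/-- Upper-triangular index pairs `(i, j)`, `i ≤ j`, row-major. [folklore] -/
def upperPairs : List (ℕ × ℕ) := (List.range 24).flatMap fun i => ((List.range 24).filter fun j => i ≤ j).map fun j => (i, j)

/-- The entries `(i, j, X i j)`, `i ≤ j`, of a table. [folklore] -/
def tableX (full : Bool) (ents : List ℤ) : List (ℕ × ℕ × ℚ) :=
  if full then List.zipWith (fun ij (v : ℤ) => (ij.1, ij.2, (v : ℚ) / 2 ^ 34)) upperPairs ents
  else List.zipWith (fun i (v : ℤ) => (i, i, (v : ℚ) / 2 ^ 34)) (List.range 24) ents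

/-- Decoded transfer classes `(b, d, bq, full, entries)` from the raw rows `[b, dk, di, dj, bq, full, e…]`. [folklore] -/
def tableClasses : List (Bool × Off × Bool × Bool × List ℤ) :=
  tableRaw442.filterMap fun r =>
    match r with
    | b :: dk :: di :: dj :: bq :: full :: ents => some (b == 1, (dk, di, dj), bq == 1, full == 1, ents)
    | _ => none

/-- TRANSFER terms at `p`: `+X(dl(p), dl(p+d))` for classes with first parity `parity p`, `−X(dl(p−d), dl(p))` for classes
with partner parity `parity p` (a symmetric table as products `X_ii z_i² + 2X_ij z_i z_j`, `i < j`). [folklore] -/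
def transferTerms (p : Site) (tcls : List (Bool × Off × Bool × Bool × List ℤ)) : List (Term 192) :=
  let b := parity p
  tcls.flatMap fun cl =>
    let X := tableX cl.2.2.2.1 cl.2.2.2.2
    let pl1 : List (ℚ × List (LinF 192)) := if cl.1 == b then [(1, dl p ++ dl (tadd p cl.2.1))] else []
    let pl2 : List (ℚ × List (LinF 192)) := if cl.2.2.1 == b then [(-1, dl (tadd p (negOff cl.2.1)) ++ dl p)] else []
    (pl1 ++ pl2).flatMap fun pz =>
      X.map fun e => (pz.1 * e.2.2 * (if e.1 = e.2.1 then 1 else 2), pz.2.getD e.1 [], pz.2.getD e.2.1 [])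

/-- NORM terms `g_c · u_{q,c}²` (Cartesian norm `‖u‖²` in the scaled frame). [folklore] -/
def normTerms : List (Term 192) :=
  allSites.flatMap fun q => [sq (gW 0) (LinF.coord (idx q 0)), sq (gW 1) (LinF.coord (idx q 1)), sq (gW 2) (LinF.coord (idx q 2))]

/-- The component sum functional `Σ_q u_{q,c}`. [folklore] -/
def sumF (c : Fin 3) : LinF 192 := allSites.map fun q => (idx q c, 1)

/-- Translation projector terms `(g_c/64)·(Σ_q u_{q,c})²`. [folklore] -/
def projTerms : List (Term 192) := [sq (gW 0 / 64) (sumF 0), sq (gW 1 / 64) (sumF 1), sq (gW 2 / 64) (sumF 2)]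

/-- Negate the weights of a term list. [folklore] -/
def negTerms (ts : List (Term 192)) : List (Term 192) := ts.map fun t => (-t.1, t.2)

/-- Scale the weights of a term list. [folklore] -/
def scaleTerms (a : ℚ) (ts : List (Term 192)) : List (Term 192) := ts.map fun t => (a * t.1, t.2)

/-! ## The forms -/

/-- SUPPLY `S_p(u)` (co-rotated half-split second variation, truncated at `4.02 a₀`). [folklore] -/
def supply (p : Site) (u : Fin 192 → ℚ) : ℚ := evalQ (supplyTerms p (thetaList p)) u
/-- TRANSFERS `T_p(u)` (antisymmetrised quadratic transfers of the witness tables). [folklore] -/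
def transfer (p : Site) (u : Fin 192 → ℚ) : ℚ := evalQ (transferTerms p tableClasses) u
/-- DEMAND `D_p(u) = κ-terms + readout form`. [folklore] -/
def demand (p : Site) (u : Fin 192 → ℚ) : ℚ :=
  evalQ (kappaTerms p (thetaList p)) u + evalQ (readoutTerms p (thetaList p) betaTable) u
/-- `‖u‖²_G = Σ_q (u_{q,0}² + 3u_{q,1}² + u_{q,2}²)` (the Cartesian norm). [folklore] -/
def normSqG (u : Fin 192 → ℚ) : ℚ := evalQ normTerms u
/-- `meanProj u = Σ_c (g_c/64)(Σ_q u_{q,c})²` (vanishes on zero-mean fields). [folklore] -/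
def meanProj (u : Fin 192 → ℚ) : ℚ := evalQ projTerms u

/-- The certificate's term list: `S + T − D − m‖u‖² + meanProj` (per-site data computed once and passed along). [folklore] -/
def certTerms (p : Site) (m : ℚ) : List (Term 192) :=
  let ths := thetaList p
  supplyTerms p ths ++ transferTerms p tableClasses ++ negTerms (kappaTerms p ths) ++
    negTerms (readoutTerms p ths betaTable) ++ scaleTerms (-m) normTerms ++ projTerms

/-- `evalQ (negTerms ts) = − evalQ ts`. [folklore] -/
theorem evalQ_negTerms (ts : List (Term 192)) (u : Fin 192 → ℚ) : evalQ (negTerms ts) u = -evalQ ts u := by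
  induction ts with
  | nil => simp [negTerms]
  | cons t ts ih => simp only [negTerms, List.map_cons, evalQ_cons] at ih ⊢; rw [ih]; ring

/-- `evalQ (scaleTerms a ts) = a · evalQ ts`. [folklore] -/
theorem evalQ_scaleTerms (a : ℚ) (ts : List (Term 192)) (u : Fin 192 → ℚ) :
    evalQ (scaleTerms a ts) u = a * evalQ ts u := by
  induction ts with
  | nil => simp [scaleTerms]
  | cons t ts ih => simp only [scaleTerms, List.map_cons, evalQ_cons] at ih ⊢; rw [ih]; ring

/-- The certificate's form is `S + T − D − m‖u‖² + meanProj`. [folklore] -/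
theorem evalQ_certTerms (p : Site) (m : ℚ) (u : Fin 192 → ℚ) :
    evalQ (certTerms p m) u = supply p u + transfer p u - demand p u - m * normSqG u + meanProj u := by
  simp only [certTerms, evalQ_append, evalQ_negTerms, evalQ_scaleTerms, supply, transfer, demand, normSqG, meanProj]
  ring

/-- `meanProj` vanishes on zero-mean fields. [folklore] -/
theorem meanProj_eq_zero {u : Fin 192 → ℚ} (h0 : ∀ c : Fin 3, (sumF c).eval u = 0) : meanProj u = 0 := by
  simp [meanProj, projTerms, sq, evalQ_cons, h0]

/-! ## The two reference sites and their certificates (computed and checked in Lean) -/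

/-- Reference A site `(0,0,0)`. -/
def siteA : Site := (0, 0, 0)
/-- Reference B site `(1,0,0)`. -/
def siteB : Site := (1, 0, 0)

/-- Assembled accumulator, parity A. -/
def accA : Acc 192 := assemble (certTerms siteA margin442)
/-- Assembled accumulator, parity B. -/
def accB : Acc 192 := assemble (certTerms siteB margin442)
/-- The symmetrised matrix of the certificate's form, parity A. -/
def matA : Matrix (Fin 192) (Fin 192) ℚ := symm accA.toMatrix
/-- The symmetrised matrix of the certificate's form, parity B. -/
def matB : Matrix (Fin 192) (Fin 192) ℚ := symm accB.toMatrix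
/-- Rounded `LDLᵀ` factor of `matA − 10⁻³·1` (40-bit rounding), computed in Lean. -/
def factA : Array ℚ × Array (Array ℚ) := certArrays 40 (1 / 1000) matA
/-- Rounded `LDLᵀ` factor of `matB − 10⁻³·1`, computed in Lean. -/
def factB : Array ℚ × Array (Array ℚ) := certArrays 40 (1 / 1000) matB

end Summit.AtomisticToContinuum.Crystallization.Theorems.StrictSplittingRuleTorusLMI
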